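import Summits.NavierStokesRegularity.OSWSelfSimilar.SheetRComplexPivot
import HarnessLib

/-!
# SHEET-ℝ frame, MODEL ASSEMBLY for Z3-SR-SPEC (P1): the COMPLEX resolvent `R(σ) : L²_w(ℂ) →L[ℂ] L²_w(ℂ)` of the linearised sheet
# operator on the half-plane `Re σ > −m`, as a genuine `ℂ`-linear bounded operator

HONEST FRAMING (cell ns-blowup GROUP B / zone Z3, case Z3-SR-SPEC, PAPER item (P1) «`R(σ) = (A + σ)⁻¹ : L²_w → dom ⊂ E` exists as a
single-valued bounded operator» for COMPLEX `σ`; 1-D MODEL certificate frame (viscous gCLM/OSW sheet on the line); not Euler/NS; «violates: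
none — MODEL»). Nothing here asserts that a profile exists. The analytic input is a GÅRDING LOWER BOUND for the real weak form on compactly
supported tests, `‖v₁‖²_w + m‖v‖²_w ≤ linForm(v; v)` (`m ∈ ℝ`; for the sheet it is the POINTWISE datum of `SheetRLinearisedCoercivity` /
`SheetRLinearisedCutoffEnergy.pivot_coercive_of_pointwise`, i.e. the certificate's interval arithmetic) — bundled with the coefficient
hypotheses of record in the hypothesis structure `GardingData`.

CONSTRUCTION.  For `σ = s + it` with `s > −m` the shifted form `linForm L d (V + s)` is `κ(σ)`-coercive, `κ(σ) = min(1, 4(m + s))`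
(`coercive_shift`), so `SheetRResolventPair.exists_pairSolutionOperator` gives the pair solution operator of the realified equation
`(A + σ)(u_R + iu_I) = g_R + ig_I` (`pairOp`, by choice; UNIQUE by `pairOp_unique`); conjugating with the real-pair coordinates of
`SheetRComplexPivot` gives an `ℝ`-linear bounded `resolventR σ` on `Wc L = Lp ℂ 2 μ_w`, which commutes with `i` because the rotated pair
solves the rotated system (`pairOp_rot`, `resolventR_I_smul`) and is therefore `ℂ`-LINEAR: **`resolvent σ : Wc L →L[ℂ] Wc L`**, with
`‖resolvent σ G‖ ≤ (8/κ(σ))‖G‖` (`norm_resolvent_le`) and the weak meaning `resolvent_weak` (its real/imaginary parts are the energy-class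
weak solution pair of the shifted skew system with data `(Re G, Im G)`).  Outside the half-plane `resolvent σ := 0` (junk value, documented).
The first resolvent identity / `IsPseudoResolvent` and the sharp pivot bound `‖R(σ)‖ ≤ 1/(m + Re σ)` are the next files.

One hypothesis structure (`GardingData`), three definitions (`pairOp`, `resolventR`, `resolvent`); no named fact.  WHAT THIS IS NOT: not NS; not
the spectral certificate; no number of record moves.
-/

noncomputable section

namespace Summit.NavierStokesRegularity.OSWSelfSimilar
namespace SheetRResolventComplex

open _root_.MeasureTheory _root_.Set _root_.Filter _root_.Real SheetRWeakProfilePV SheetRWeakToStrong SheetREnergyClass SheetRWeightedMeasure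
  SheetRLinearisedTests SheetREnergySpace SheetRTestSpace SheetRLinearisedFormBounds SheetRSolutionOperator SheetRLinearisedCutoffEnergy
  SheetRResolventPair SheetRComplexPivot
open scoped Topology ENNReal

/-! ### §1 The hypothesis structure and the shifted forms -/

/-- **Coefficient data with a Gårding bound.** Drift `d` and potential `V` a.e.-strongly measurable with `|d(ξ)| ≤ D₀ + D₁|ξ|`, `|V| ≤ V₀`
(`D₀, D₁ ≥ 0`), and the Gårding lower bound `‖v₁‖²_w + m‖v‖²_w ≤ linForm(v; v)` on every compactly supported odd energy-class test
(`w = L² + ξ²`; `m ∈ ℝ` may be negative). [folklore] -/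
structure GardingData (L : ℝ) (d V : ℝ → ℝ) (D₀ D₁ V₀ m : ℝ) : Prop where
  /-- `d` is a.e.-strongly measurable -/
  d_meas : AEStronglyMeasurable d volume
  /-- `V` is a.e.-strongly measurable -/
  V_meas : AEStronglyMeasurable V volume
  /-- `D₀ ≥ 0` -/
  D₀_nonneg : 0 ≤ D₀
  /-- `D₁ ≥ 0` -/
  D₁_nonneg : 0 ≤ D₁
  /-- linear growth of the drift -/
  d_le : ∀ ξ, |d ξ| ≤ D₀ + D₁ * |ξ|
  /-- boundedness of the potential -/
  V_le : ∀ ξ, |V ξ| ≤ V₀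
  /-- the Gårding lower bound on compactly supported tests -/
  garding : ∀ v v₁ : ℝ → ℝ, IsCompactTest v v₁ →
    (∫ ξ, (L ^ 2 + ξ ^ 2) * v₁ ξ ^ 2) + m * ∫ ξ, (L ^ 2 + ξ ^ 2) * v ξ ^ 2 ≤ linForm L d V v v₁ v v₁

variable {L D₀ D₁ V₀ m : ℝ} {d V : ℝ → ℝ}

/-- The shifted potential `V + s` is a.e.-strongly measurable and bounded by `V₀ + |s|`. [folklore] -/
theorem shift_hyps (h : GardingData L d V D₀ D₁ V₀ m) (s : ℝ) :
    AEStronglyMeasurable (fun ξ => V ξ + s) volume ∧ ∀ ξ, |V ξ + s| ≤ V₀ + |s| :=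
  ⟨h.V_meas.add aestronglyMeasurable_const, fun ξ => (abs_add_le _ _).trans (add_le_add (h.V_le ξ) le_rfl)⟩

/-- **Shift of the potential**: for an energy-class profile `(u, u₁)` and a compactly supported test `(φ, φ₁)`,
`linForm L d (V + s) u u₁ φ φ₁ = linForm L d V u u₁ φ φ₁ + s·∫ w u φ`. [folklore] -/
theorem linForm_shift (h : GardingData L d V D₀ D₁ V₀ m) (hL : 0 < L) (s : ℝ) {u u₁ φ φ₁ : ℝ → ℝ} (hφ : IsCompactTest φ φ₁)
    (hum : AEStronglyMeasurable u volume) (hu₁m : AEStronglyMeasurable u₁ volume)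
    (h0 : Integrable fun y => (L ^ 2 + y ^ 2) * u y ^ 2) (h1 : Integrable fun y => (L ^ 2 + y ^ 2) * u₁ y ^ 2) :
    Integrable (fun y => (L ^ 2 + y ^ 2) * (u y * φ y)) ∧
      linForm L d (fun ξ => V ξ + s) u u₁ φ φ₁ = linForm L d V u u₁ φ φ₁ + s * ∫ y, (L ^ 2 + y ^ 2) * (u y * φ y) := by
  obtain ⟨hint, -⟩ := abs_linForm_le hL h.d_meas h.V_meas h.D₁_nonneg h.d_le h.V_le hφ hum hu₁m h0 h1
  obtain ⟨hc, -, -, -⟩ := basic_of_isCompactTest hφ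
  have hwφ := (weighted_of_isCompactTest (L := L) hφ).1
  obtain ⟨hi, -⟩ := integral_weight_abs_mul_le (L := L) hum hc.aestronglyMeasurable h0 hwφ
  have huφ : Integrable (fun y => (L ^ 2 + y ^ 2) * (u y * φ y)) := by
    refine hi.mono' ((by fun_prop : AEStronglyMeasurable (fun y : ℝ => L ^ 2 + y ^ 2) volume).mul
      (hum.mul hc.aestronglyMeasurable)) (Eventually.of_forall fun y => ?_)
    rw [Real.norm_eq_abs, abs_mul, abs_of_nonneg (by positivity : (0:ℝ) ≤ L ^ 2 + y ^ 2)]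
  refine ⟨huφ, ?_⟩
  unfold linForm
  rw [← integral_const_mul, ← integral_add hint (huφ.const_mul s)]
  refine integral_congr_ae (Eventually.of_forall fun y => ?_)
  ring

/-- The coercivity constant of the shifted form: `κ(s) = min(1, 4(m + s))`, positive for `s > −m` and at most `1`. [folklore] -/
theorem kappa_pos_le {s : ℝ} (hs : -m < s) : 0 < min 1 (4 * (m + s)) ∧ min 1 (4 * (m + s)) ≤ 1 :=
  ⟨lt_min one_pos (by linarith), min_le_left _ _⟩

/-- **Coercivity of the shifted form**: for `s > −m`, `κ(s)(‖v₁‖²_w + ¼‖v‖²_w) ≤ linForm L d (V + s) v v₁ v v₁` on every compactly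
supported test. [folklore] -/
theorem coercive_shift (h : GardingData L d V D₀ D₁ V₀ m) (hL : 0 < L) {s : ℝ} (hs : -m < s) (v v₁ : ℝ → ℝ) (hv : IsCompactTest v v₁) :
    min 1 (4 * (m + s)) * ((∫ ξ, (L ^ 2 + ξ ^ 2) * v₁ ξ ^ 2) + 1 / 4 * ∫ ξ, (L ^ 2 + ξ ^ 2) * v ξ ^ 2) ≤
      linForm L d (fun ξ => V ξ + s) v v₁ v v₁ := by
  obtain ⟨hc, -, -, -⟩ := basic_of_isCompactTest hv
  obtain ⟨hwv, hwv₁⟩ := weighted_of_isCompactTest (L := L) hv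
  obtain ⟨-, hshift⟩ := linForm_shift h hL s hv hc.aestronglyMeasurable hv.memLp.1 hwv hwv₁
  have e : ∫ y, (L ^ 2 + y ^ 2) * (v y * v y) = ∫ y, (L ^ 2 + y ^ 2) * v y ^ 2 :=
    integral_congr_ae (Eventually.of_forall fun y => by ring)
  rw [hshift, e]
  have hG := h.garding v v₁ hv
  obtain ⟨hκ, hκ1⟩ := kappa_pos_le (m := m) hs
  have hκ4 : min 1 (4 * (m + s)) ≤ 4 * (m + s) := min_le_right _ _
  have hn0 : 0 ≤ ∫ ξ, (L ^ 2 + ξ ^ 2) * v ξ ^ 2 := integral_nonneg fun y => by positivity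
  have hn1 : 0 ≤ ∫ ξ, (L ^ 2 + ξ ^ 2) * v₁ ξ ^ 2 := integral_nonneg fun y => by positivity
  nlinarith

/-- **Gårding bound from a pointwise datum**: `d ∈ C¹`, `V` bounded measurable and `m·w ≤ wV − 1 − ξd − ½w d′` pointwise give the Gårding
lower bound `‖v₁‖²_w + m‖v‖²_w ≤ linForm(v; v)`. [folklore] -/
theorem garding_of_pointwise (L : ℝ) (hdC : ContDiff ℝ 1 d) (hVm : AEStronglyMeasurable V volume) (hV : ∀ ξ, |V ξ| ≤ V₀)
    (hpt : ∀ ξ, m * (L ^ 2 + ξ ^ 2) ≤ (L ^ 2 + ξ ^ 2) * V ξ - 1 - ξ * d ξ - 1 / 2 * (L ^ 2 + ξ ^ 2) * deriv d ξ)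
    (v v₁ : ℝ → ℝ) (hv : IsCompactTest v v₁) :
    (∫ ξ, (L ^ 2 + ξ ^ 2) * v₁ ξ ^ 2) + m * ∫ ξ, (L ^ 2 + ξ ^ 2) * v ξ ^ 2 ≤ linForm L d V v v₁ v v₁ := by
  rw [SheetRLinearisedCoercivity.linForm_diag_eq L hdC hVm hV hv]
  obtain ⟨hwv, -⟩ := weighted_of_isCompactTest (L := L) hv
  have hP : Integrable fun y => ((L ^ 2 + y ^ 2) * V y - 1 - y * d y - 1 / 2 * (L ^ 2 + y ^ 2) * deriv d y) * v y ^ 2 := by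
    have h1 : Integrable fun y => (L ^ 2 + y ^ 2) * V y * v y ^ 2 :=
      SheetRLinearisedCoercivity.integrable_weight_potential_mul_sq hVm hV hv
    have hd'c : Continuous (deriv d) := hdC.continuous_deriv le_rfl
    have hdc : Continuous d := hdC.continuous
    have h2 : Integrable fun y => (-1 - y * d y - 1 / 2 * (L ^ 2 + y ^ 2) * deriv d y) * v y ^ 2 :=
      SheetRLinearisedCoercivity.integrable_continuous_mul_sq (by fun_prop) hv
    refine (h1.add h2).congr (Eventually.of_forall fun y => ?_)
    simp only [Pi.add_apply]; ring
  have hmono : m * ∫ ξ, (L ^ 2 + ξ ^ 2) * v ξ ^ 2 ≤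
      ∫ y, ((L ^ 2 + y ^ 2) * V y - 1 - y * d y - 1 / 2 * (L ^ 2 + y ^ 2) * deriv d y) * v y ^ 2 := by
    rw [← integral_const_mul]
    refine integral_mono (hwv.const_mul _) hP fun y => ?_
    have := mul_le_mul_of_nonneg_right (hpt y) (sq_nonneg (v y))
    simpa only [mul_assoc] using this
  linarith

/-! ### §2 The pair solution operator at a spectral parameter `σ` with `Re σ > −m` -/

section Resolvent

/-- Existence of the pair solution operator of the realified `(A + σ)`, `Re σ > −m`. [folklore] -/
theorem exists_pairOp (hL : 0 < L) (h : GardingData L d V D₀ D₁ V₀ m) (σ : ℂ) (hσ : -m < σ.re) :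
    ∃ S : WithLp 2 (W L × W L) →L[ℝ] WithLp 2 (Esp L hL × Esp L hL),
      (∀ (G : WithLp 2 (W L × W L)) (v v₁ : ℝ → ℝ), IsCompactTest v v₁ →
        linForm L d (fun ξ => V ξ + σ.re) (prim (der (S G).fst)) (der (S G).fst) v v₁
              - σ.im * ∫ y, (L ^ 2 + y ^ 2) * (prim (der (S G).snd) y * v y) = ∫ y, (L ^ 2 + y ^ 2) * ((G.fst : ℝ → ℝ) y * v y) ∧
          linForm L d (fun ξ => V ξ + σ.re) (prim (der (S G).snd)) (der (S G).snd) v v₁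
              + σ.im * ∫ y, (L ^ 2 + y ^ 2) * (prim (der (S G).fst) y * v y) = ∫ y, (L ^ 2 + y ^ 2) * ((G.snd : ℝ → ℝ) y * v y)) ∧
      ∀ G : WithLp 2 (W L × W L), ‖S G‖ ≤ 4 / min 1 (4 * (m + σ.re)) * ‖G‖ :=
  exists_pairSolutionOperator hL h.d_meas (shift_hyps h σ.re).1 h.D₁_nonneg h.d_le (shift_hyps h σ.re).2 σ.im (kappa_pos_le hσ).1
    (coercive_shift h hL hσ)

/-- **The pair solution operator** at `σ` (`Re σ > −m`), by choice from `exists_pairOp`; unique by `pairOp_unique`. [folklore] -/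
def pairOp (hL : 0 < L) (h : GardingData L d V D₀ D₁ V₀ m) (σ : ℂ) (hσ : -m < σ.re) : WithLp 2 (W L × W L) →L[ℝ] WithLp 2 (Esp L hL × Esp L hL) :=
  Classical.choose (exists_pairOp hL h σ hσ)

/-- The defining property of `pairOp`: the weak pair system and the bound `‖pairOp σ G‖ ≤ (4/κ(σ))‖G‖`. [folklore] -/
theorem pairOp_spec (hL : 0 < L) (h : GardingData L d V D₀ D₁ V₀ m) (σ : ℂ) (hσ : -m < σ.re) :
    (∀ (G : WithLp 2 (W L × W L)) (v v₁ : ℝ → ℝ), IsCompactTest v v₁ →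
        linForm L d (fun ξ => V ξ + σ.re) (prim (der (pairOp hL h σ hσ G).fst)) (der (pairOp hL h σ hσ G).fst) v v₁
              - σ.im * ∫ y, (L ^ 2 + y ^ 2) * (prim (der (pairOp hL h σ hσ G).snd) y * v y) =
            ∫ y, (L ^ 2 + y ^ 2) * ((G.fst : ℝ → ℝ) y * v y) ∧
          linForm L d (fun ξ => V ξ + σ.re) (prim (der (pairOp hL h σ hσ G).snd)) (der (pairOp hL h σ hσ G).snd) v v₁
              + σ.im * ∫ y, (L ^ 2 + y ^ 2) * (prim (der (pairOp hL h σ hσ G).fst) y * v y) =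
            ∫ y, (L ^ 2 + y ^ 2) * ((G.snd : ℝ → ℝ) y * v y)) ∧
      ∀ G : WithLp 2 (W L × W L), ‖pairOp hL h σ hσ G‖ ≤ 4 / min 1 (4 * (m + σ.re)) * ‖G‖ :=
  Classical.choose_spec (exists_pairOp hL h σ hσ)

/-- **Uniqueness**: an energy-space pair solving the `σ`-system weakly with data `G` IS `pairOp σ G`. [folklore] -/
theorem pairOp_unique (hL : 0 < L) (h : GardingData L d V D₀ D₁ V₀ m) (σ : ℂ) (hσ : -m < σ.re) (G : WithLp 2 (W L × W L)) {Q : WithLp 2 (Esp L hL × Esp L hL)}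
    (hQ : ∀ v v₁ : ℝ → ℝ, IsCompactTest v v₁ →
      linForm L d (fun ξ => V ξ + σ.re) (prim (der Q.fst)) (der Q.fst) v v₁
            - σ.im * ∫ y, (L ^ 2 + y ^ 2) * (prim (der Q.snd) y * v y) = ∫ y, (L ^ 2 + y ^ 2) * ((G.fst : ℝ → ℝ) y * v y) ∧
        linForm L d (fun ξ => V ξ + σ.re) (prim (der Q.snd)) (der Q.snd) v v₁
            + σ.im * ∫ y, (L ^ 2 + y ^ 2) * (prim (der Q.fst) y * v y) = ∫ y, (L ^ 2 + y ^ 2) * ((G.snd : ℝ → ℝ) y * v y)) :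
    Q = pairOp hL h σ hσ G :=
  pairSolution_unique hL h.d_meas (shift_hyps h σ.re).1 h.D₀_nonneg h.D₁_nonneg h.d_le (shift_hyps h σ.re).2 σ.im
    (kappa_pos_le hσ).1 (coercive_shift h hL hσ) hQ (fun v v₁ hv => (pairOp_spec hL h σ hσ).1 G v v₁ hv)

/-- Profile of a negated energy-space element: `prim (der (−q)) = −prim (der q)` pointwise and `der (−q) = −der q` a.e. [folklore] -/
theorem der_neg (hL : 0 < L) (q : Esp L hL) :
    (der (-q) =ᵐ[volume] fun y => -1 * der q y) ∧ prim (der (-q)) = fun x => -1 * prim (der q) x := by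
  have e : -q = (-1 : ℝ) • q := (neg_one_smul ℝ q).symm
  rw [e]
  exact der_smul hL (-1) q

/-- **Rotation**: `pairOp σ (−g_I, g_R) = (−p_I, p_R)` where `(p_R, p_I) = pairOp σ (g_R, g_I)` — the realified form of `ℂ`-linearity. [folklore] -/
theorem pairOp_rot (hL : 0 < L) (h : GardingData L d V D₀ D₁ V₀ m) (σ : ℂ) (hσ : -m < σ.re) (G : WithLp 2 (W L × W L)) :
    pairOp hL h σ hσ (WithLp.toLp 2 (-G.snd, G.fst)) =
      WithLp.toLp 2 (-(pairOp hL h σ hσ G).snd, (pairOp hL h σ hσ G).fst) := by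
  set Q := pairOp hL h σ hσ G with hQdef
  have hQ := (pairOp_spec hL h σ hσ).1 G
  symm
  refine pairOp_unique hL h σ hσ _ fun v v₁ hv => ?_
  obtain ⟨e1, e2⟩ := hQ v v₁ hv
  have hR1 : (WithLp.toLp 2 (-Q.snd, Q.fst) : WithLp 2 (Esp L hL × Esp L hL)).fst = -Q.snd := rfl
  have hR2 : (WithLp.toLp 2 (-Q.snd, Q.fst) : WithLp 2 (Esp L hL × Esp L hL)).snd = Q.fst := rfl
  have hD1 : (WithLp.toLp 2 (-G.snd, G.fst) : WithLp 2 (W L × W L)).fst = -G.snd := rfl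
  have hD2 : (WithLp.toLp 2 (-G.snd, G.fst) : WithLp 2 (W L × W L)).snd = G.fst := rfl
  rw [hR1, hR2, hD1, hD2]
  obtain ⟨hneg_ae, hneg_prim⟩ := der_neg hL Q.snd
  -- the negated profile inside `linForm` and inside the coupling integral
  have hlin : linForm L d (fun ξ => V ξ + σ.re) (prim (der (-Q.snd))) (der (-Q.snd)) v v₁ =
      -1 * linForm L d (fun ξ => V ξ + σ.re) (prim (der Q.snd)) (der Q.snd) v v₁ := by
    rw [linForm_congr_ae L d _ (Eventually.of_forall fun y => congrFun hneg_prim y) hneg_ae]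
    exact linForm_smul_left L d _ (-1)
  have hcpl : ∫ y, (L ^ 2 + y ^ 2) * (prim (der (-Q.snd)) y * v y) = -1 * ∫ y, (L ^ 2 + y ^ 2) * (prim (der Q.snd) y * v y) := by
    rw [← integral_const_mul]
    refine integral_congr_ae (Eventually.of_forall fun y => ?_)
    show (L ^ 2 + y ^ 2) * (prim (der (-Q.snd)) y * v y) = -1 * ((L ^ 2 + y ^ 2) * (prim (der Q.snd) y * v y))
    rw [congrFun hneg_prim y]; ring
  have hdat : ∫ y, (L ^ 2 + y ^ 2) * ((((-G.snd : W L)) : ℝ → ℝ) y * v y) = -1 * ∫ y, (L ^ 2 + y ^ 2) * ((G.snd : ℝ → ℝ) y * v y) := by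
    rw [← integral_const_mul]
    refine integral_congr_ae ((ae_volume_of_ae_μw hL (Lp.coeFn_neg (G.snd : W L))).mono fun y hy => ?_)
    show (L ^ 2 + y ^ 2) * (((-G.snd : W L) : ℝ → ℝ) y * v y) = -1 * ((L ^ 2 + y ^ 2) * ((G.snd : ℝ → ℝ) y * v y))
    rw [hy, Pi.neg_apply]; ring
  refine ⟨?_, ?_⟩
  · rw [hlin, hdat]; linarith
  · rw [hcpl]; linarith

/-! ### §3 The resolvent on the complex pivot space -/

/-- The `ℝ`-linear resolvent `ofPair ∘ ιpair ∘ pairOp σ ∘ toPair` on `Wc L = Lp ℂ 2 μ_w` (`0` outside the half-plane `Re σ > −m`). [folklore] -/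
def resolventR (hL : 0 < L) (h : GardingData L d V D₀ D₁ V₀ m) (σ : ℂ) : Wc L →L[ℝ] Wc L :=
  if hσ : -m < σ.re then (ofPair L).comp ((ιpair hL).comp ((pairOp hL h σ hσ).comp (toPair L))) else 0

/-- Formula for `resolventR` inside the half-plane. [folklore] -/
theorem resolventR_apply (hL : 0 < L) (h : GardingData L d V D₀ D₁ V₀ m) {σ : ℂ} (hσ : -m < σ.re) (G : Wc L) :
    resolventR hL h σ G = ofPair L (ιpair hL (pairOp hL h σ hσ (toPair L G))) := by
  rw [resolventR, dif_pos hσ]; rfl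

/-- `resolventR σ = 0` outside the half-plane (junk value). [folklore] -/
theorem resolventR_of_not (hL : 0 < L) (h : GardingData L d V D₀ D₁ V₀ m) {σ : ℂ} (hσ : ¬ -m < σ.re) : resolventR hL h σ = 0 := by
  rw [resolventR, dif_neg hσ]

/-- **`resolventR σ` commutes with multiplication by `i`.** [folklore] -/
theorem resolventR_I_smul (hL : 0 < L) (h : GardingData L d V D₀ D₁ V₀ m) (σ : ℂ) (G : Wc L) : resolventR hL h σ ((Complex.I : ℂ) • G) = (Complex.I : ℂ) • resolventR hL h σ G := by
  by_cases hσ : -m < σ.re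
  · rw [resolventR_apply hL h hσ, resolventR_apply hL h hσ]
    have hrot : toPair L ((Complex.I : ℂ) • G) = WithLp.toLp 2 (-(toPair L G).snd, (toPair L G).fst) :=
      WithLp.ofLp_injective 2 (Prod.ext (toPair_I_smul G).1 (toPair_I_smul G).2)
    rw [hrot, pairOp_rot hL h σ hσ]
    set Q := pairOp hL h σ hσ (toPair L G)
    have hι : ιpair hL (WithLp.toLp 2 (-Q.snd, Q.fst)) = WithLp.toLp 2 (-(ιpair hL Q).snd, (ιpair hL Q).fst) := by
      obtain ⟨h1, h2⟩ := ιpair_fst_snd hL Q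
      obtain ⟨h1', h2'⟩ := ιpair_fst_snd hL (WithLp.toLp 2 (-Q.snd, Q.fst) : WithLp 2 (Esp L hL × Esp L hL))
      refine WithLp.ofLp_injective 2 (Prod.ext ?_ ?_)
      · show (ιpair hL (WithLp.toLp 2 (-Q.snd, Q.fst))).fst = -(ιpair hL Q).snd
        rw [h1', h2]; exact map_neg (ιE hL) Q.snd
      · show (ιpair hL (WithLp.toLp 2 (-Q.snd, Q.fst))).snd = (ιpair hL Q).fst
        rw [h2', h1]; rfl
    rw [hι, ofPair_rot]
  · rw [resolventR_of_not hL h hσ]; simp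

/-- **THE RESOLVENT** `R(σ) : L²_w(ℂ) →L[ℂ] L²_w(ℂ)` of the linearised sheet operator (`ℂ`-linear; `0` outside `Re σ > −m`). [folklore] -/
def resolvent (hL : 0 < L) (h : GardingData L d V D₀ D₁ V₀ m) (σ : ℂ) : Wc L →L[ℂ] Wc L :=
  toComplexCLM (resolventR hL h σ) (resolventR_I_smul hL h σ)

/-- `resolvent σ` acts as `resolventR σ`. [folklore] -/
theorem resolvent_apply (hL : 0 < L) (h : GardingData L d V D₀ D₁ V₀ m) (σ : ℂ) (G : Wc L) : resolvent hL h σ G = resolventR hL h σ G := rfl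

/-- `resolvent σ = 0` outside the half-plane (junk value). [folklore] -/
theorem resolvent_of_not (hL : 0 < L) (h : GardingData L d V D₀ D₁ V₀ m) {σ : ℂ} (hσ : ¬ -m < σ.re) : resolvent hL h σ = 0 := by
  ext G; rw [resolvent_apply, resolventR_of_not hL h hσ]; rfl

/-- **Weak meaning of the resolvent.** For `Re σ > −m` and `G ∈ L²_w(ℂ)`, with `(p_R, p_I) = pairOp σ (Re G, Im G)`:
`resolvent σ G = ofPair (ιE p_R, ιE p_I)` — i.e. `Re R(σ)G = prim (der p_R)`, `Im R(σ)G = prim (der p_I)` a.e. — and the profiles solve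
`linForm_{V+Re σ}(u_R; v) − Im σ·∫w u_I v = ∫ w (Re G) v`, `linForm_{V+Re σ}(u_I; v) + Im σ·∫w u_R v = ∫ w (Im G) v` on every compactly
supported test. [folklore] -/
theorem resolvent_weak (hL : 0 < L) (h : GardingData L d V D₀ D₁ V₀ m) {σ : ℂ} (hσ : -m < σ.re) (G : Wc L) :
    resolvent hL h σ G = ofPair L (ιpair hL (pairOp hL h σ hσ (toPair L G))) ∧
      (((reW L (resolvent hL h σ G) : W L) : ℝ → ℝ) =ᵐ[volume] prim (der (pairOp hL h σ hσ (toPair L G)).fst)) ∧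
      (((imW L (resolvent hL h σ G) : W L) : ℝ → ℝ) =ᵐ[volume] prim (der (pairOp hL h σ hσ (toPair L G)).snd)) ∧
      ∀ v v₁ : ℝ → ℝ, IsCompactTest v v₁ →
        linForm L d (fun ξ => V ξ + σ.re) (prim (der (pairOp hL h σ hσ (toPair L G)).fst)) (der (pairOp hL h σ hσ (toPair L G)).fst) v v₁
              - σ.im * ∫ y, (L ^ 2 + y ^ 2) * (prim (der (pairOp hL h σ hσ (toPair L G)).snd) y * v y) =
            ∫ y, (L ^ 2 + y ^ 2) * (((reW L G : W L) : ℝ → ℝ) y * v y) ∧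
          linForm L d (fun ξ => V ξ + σ.re) (prim (der (pairOp hL h σ hσ (toPair L G)).snd)) (der (pairOp hL h σ hσ (toPair L G)).snd) v v₁
              + σ.im * ∫ y, (L ^ 2 + y ^ 2) * (prim (der (pairOp hL h σ hσ (toPair L G)).fst) y * v y) =
            ∫ y, (L ^ 2 + y ^ 2) * (((imW L G : W L) : ℝ → ℝ) y * v y) := by
  have happ : resolvent hL h σ G = ofPair L (ιpair hL (pairOp hL h σ hσ (toPair L G))) := by
    rw [resolvent_apply, resolventR_apply hL h hσ]
  set Q := pairOp hL h σ hσ (toPair L G) with hQ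
  have hpair : toPair L (resolvent hL h σ G) = ιpair hL Q := by rw [happ, toPair_ofPair]
  obtain ⟨hc1, hc2⟩ := toPair_fst_snd (resolvent hL h σ G)
  obtain ⟨hi1, hi2⟩ := ιpair_fst_snd hL Q
  refine ⟨happ, ?_, ?_, fun v v₁ hv => (pairOp_spec hL h σ hσ).1 (toPair L G) v v₁ hv⟩
  · rw [← hc1, hpair, hi1]; exact ιE_ae hL Q.fst
  · rw [← hc2, hpair, hi2]; exact ιE_ae hL Q.snd

/-- **Norm bound**: `‖resolvent σ G‖ ≤ (8/κ(σ))‖G‖`, `κ(σ) = min(1, 4(m + Re σ))`, for `Re σ > −m`. [folklore] -/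
theorem norm_resolvent_le (hL : 0 < L) (h : GardingData L d V D₀ D₁ V₀ m) {σ : ℂ} (hσ : -m < σ.re) (G : Wc L) :
    ‖resolvent hL h σ G‖ ≤ 8 / min 1 (4 * (m + σ.re)) * ‖G‖ := by
  obtain ⟨happ, -, -, -⟩ := resolvent_weak hL h hσ G
  obtain ⟨hκ, -⟩ := kappa_pos_le (m := m) hσ
  rw [happ, norm_ofPair]
  have h1 := norm_ιpair_le hL (pairOp hL h σ hσ (toPair L G))
  have h2 := (pairOp_spec hL h σ hσ).2 (toPair L G)
  rw [norm_toPair] at h2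
  calc ‖ιpair hL (pairOp hL h σ hσ (toPair L G))‖ ≤ 2 * ‖pairOp hL h σ hσ (toPair L G)‖ := h1
    _ ≤ 2 * (4 / min 1 (4 * (m + σ.re)) * ‖G‖) := by gcongr
    _ = 8 / min 1 (4 * (m + σ.re)) * ‖G‖ := by ring

end Resolvent

end SheetRResolventComplex
end Summit.NavierStokesRegularity.OSWSelfSimilar

end
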